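import Summits.QuantumFields.YangMills.Theorems.UnitScaleTiltFluctuationComparisonRegPrOfFourV5e
import Summits.QuantumFields.YangMills.Theorems.UnitScaleTiltMinimiserStabilityRegPrResidueThree
import Summits.QuantumFields.YangMills.Theorems.UnitScaleTiltMinimiserStabilityRegPrOfB8Thm2AtT3Members
import HarnessLib

/-!
# Route `UnitScaleTilt` — aside K1 `UnitTilt` (stmt-QuantumFields-18915): **THE ROUTE DECL BY NAME FROM ITS RESIDUE BY KERNEL** —
# `UnitTilt ⟸ {⟨[Balaban1985Variational] Prop. 7 existence clause at L = 3⟩, (L) lane inputs, (A) α⁺ in the `TrivRegions ∧ TwoRunLv` currency, (E) minimiser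
# two-cut-off closeness, (S) odd-`L < 7` supplement}` (support file `--supports stmt-QuantumFields-18915`; conditional; credits nothing to any item)

Cell `ym3-torus` (HUMAN RULING D-0037: YM₃ on T³ is ladder rung R3), seat `leafhand-qf-unitscaletilt-2` gen 0.

WHY.  The registered skeleton of the aside 18915 (`Cruxes/UnitTilt/Lines/printed_regular_background.lean`, sha16 5f0eb99072ca5baa) has two stubs whose texts ARE
the sibling items: `stub_minimiserRegPr` = crux 19200 `MinimiserStabilityRegPr` and `stub_fluctuationRegPr` = aside 19201 `FluctuationComparisonRegPr` (unit
leafhand-qf-unitscaletilt-1, evidence #11, `Iff.rfl` probes), glued by ✓`T3PrintedRegularMinimiser.unitTilt_shape_of_regPr` (p415317; = the glue item 19202 ✓`unitScaleTilt_unitTilt_of_regPr` p416206 read per `L`).  Since then the tree settled most of both: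
(i) 19200's body holds OUTRIGHT at every block size `L ≥ 5` (✓`EXGuardedFiveOutright.minimiserStabilityRegPr_guarded_five`, px16 g16 p790882) and the crux BY
NAME follows from the Prop. 7 existence clause AT `L = 3` ALONE (✓`MinimiserStabilityRegPrResidueThree.minimiserStabilityRegPr_of_exBody_three`, ★p1 p792443);
(ii) 19201 BY NAME follows from four displayed binders with STUB 1 and S-E″ discharged (✓`FluctuationComparisonRegPrOfFourV5e.fluctuationComparisonRegPr_of_four`,
this seat).  THIS FILE composes (i), (ii) and the glue: `UnitTilt` BY NAME from FIVE displayed hypotheses, each the text of a registered stub or of a located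
print statement — so the aside's residue BY KERNEL is {EX@3 (located residue LF-1EX of the cell: lit-balaban `KIdx.hℓ : 4 ≤ ℓ`), NODE O's (α) package (L), the
two-run comparison with the datum (A), [Balaban1985Variational] Thm 1 two-cut-off closeness (E), the small-block supplement (S)} and nothing else.

§3–§4 give the same two readings with the anonymous ⟨EX body at L = 3⟩ replaced by the cell's NAMED Literature fact `T3B8Thm2AtMembers.B8Thm2AtT3Members`
([Balaban1985RegularSpaces] Thm 2 at the members of the T³ families — a theorem for every `L ≥ 5`, OPEN at `L = 3`; RECORD 17fj∕17fk), through ★p1's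
✓`MinimiserStabilityRegPrOfB8Thm2AtT3Members.minimiserStabilityRegPr_of_b8Thm2AtT3Members` (p793522): «`UnitTilt` ⟸ {ONE named Literature fact, aside 19201}».

WHAT THIS IS NOT.  CONDITIONAL on all displayed binders (the named fact makes §3–§4 `conditional-result`s in the gate's sense); closes nothing; no `def`, no `sorry`.  18915 is an ASIDE (rev 14 `closes` bypasses it; the rung of record is
`YM3TorusSU2Adm` ⟸ {20520, 19936}); no crux, no rung, no summit is proved here; rung R3 = SU(2) YM₃ on T³ — not d = 4, not infinite volume, not a mass gap, not Clay.

References: T. Bałaban, CMP 102 (1985) 277–309 [Balaban1985Variational] (Thm 1 (6)–(10) pp.278–279, Prop. 7 p.299); CMP 99 (1985) 75–102 [Balaban1985RegularSpaces]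
(Thm 2 p.83); CMP 102 (1985) 255–275 [Balaban1985UV3] (Thm 2 p.272, (41) p.266, (47) p.267); C. King, CMP 102 (1986) 649–677 [King1986] (Thm 3.4 (3.9) p.656,
Prop. 3.9 pp.664–665).
-/

set_option autoImplicit false

noncomputable section

namespace Summit.QuantumFields.YangMills.Theorems.UnitTiltOfResidue

open MeasureTheory Filter Topology
open Literature.MathematicalPhysics.QuantumFieldTheory.Balaban1983to89
open Literature.MathematicalPhysics.QuantumFieldTheory.Balaban1983to89.T3ContinuumYM3Torus
open Literature.MathematicalPhysics.QuantumFieldTheory.Balaban1983to89.T3LevelShift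
open Literature.MathematicalPhysics.QuantumFieldTheory.Balaban1983to89.T3UnitLawDensityEML (ℰp measurableE_ℰp)
open Literature.MathematicalPhysics.QuantumFieldTheory.Balaban1983to89.T3UnitScaleTilt
open Literature.MathematicalPhysics.QuantumFieldTheory.Balaban1983to89.T3RestrictedUnitDensity
open Literature.MathematicalPhysics.QuantumFieldTheory.Balaban1983to89.T3TiltDescent
open Literature.MathematicalPhysics.QuantumFieldTheory.Balaban1983to89.T3ConstrainedMinimiser
open Literature.MathematicalPhysics.QuantumFieldTheory.Balaban1983to89.T3RegularMinimiser
open Literature.MathematicalPhysics.QuantumFieldTheory.Balaban1983to89.T3PrintedRegularMinimiser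
open Literature.MathematicalPhysics.QuantumFieldTheory.Balaban1983to89.T3SmallLiftHistory
open Literature.MathematicalPhysics.QuantumFieldTheory.Balaban1983to89.T3LogComparisonSocket
open Literature.MathematicalPhysics.QuantumFieldTheory.Balaban1983to89.T3AlphaInputsAC
open Literature.MathematicalPhysics.QuantumFieldTheory.Balaban1983to89.T3AlphaInputsACTwoRun
open Literature.MathematicalPhysics.QuantumFieldTheory.Balaban1983to89.T3AlphaInputsACTwoRunLevel
open Literature.MathematicalPhysics.QuantumFieldTheory.Balaban1983to89.Missing
open Literature.MathematicalPhysics.QuantumFieldTheory.Balaban1983to89.T4Continuum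
open Literature.MathematicalPhysics.QuantumFieldTheory.Balaban1983to89.T3B8Thm2AtMembers (B8Thm2AtT3Members)

/-- ★★ **`UnitTilt` BY NAME ⟸ ⟨EX body at `L = 3`⟩ ∧ `FluctuationComparisonRegPr` BY NAME** — the aside 18915 from the cell's located residue of crux 19200
(✓`minimiserStabilityRegPr_of_exBody_three`: L ≥ 5 outright, L = 3 the binder) and the sibling aside 19201 taken by name; glue ✓`unitTilt_shape_of_regPr` per `L`.
CONDITIONAL; credits nothing. [cite: Balaban1985Variational, Prop. 7 p.299; King1986, Thm 3.4 (3.9) p.656] -/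
theorem unitTilt_of_exBodyThree_fluctuationComparisonRegPr
    (hEX3 : ∀ (B₃ : ℝ), 4 < B₃ → ∃ a₁' O₁ : ℝ, 0 < a₁' ∧ 1 ≤ O₁ ∧
      ∀ (F : T3Family), F.L = 3 → ∀ (n K : ℕ) (hnK : n < K) (ε₁ : ℝ), 0 < ε₁ →
        ∀ V : GaugeField (F.P n) 0 (Matrix.specialUnitaryGroup (Fin 2) ℂ), PlaqSmall ε₁ V →
          ∀ U₀ : GaugeField (F.P K) 0 (Matrix.specialUnitaryGroup (Fin 2) ℂ), RegPr F n K (((3 : ℕ) : ℝ) ^ 3 * B₃ * ε₁) U₀ →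
            U₀ ∈ fibre F ℰp n K hnK.le V →
            ε₁ ≤ a₁' → ∃ U ∈ regFibrePr F n K hnK.le (O₁ * ((3 : ℕ) : ℝ) ^ 3 * B₃ * ε₁) V,
              IsMinOn (fun W : GaugeField (F.P K) 0 (Matrix.specialUnitaryGroup (Fin 2) ℂ) => wilsonAction4 W)
                (regFibrePr F n K hnK.le (O₁ * ((3 : ℕ) : ℝ) ^ 3 * B₃ * ε₁) V) U)
    (h201 : Summit.QuantumFields.YangMills.Theses.UnitScaleTilt.FluctuationComparisonRegPr) :
    Summit.QuantumFields.YangMills.Theses.UnitScaleTilt.UnitTilt := by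
  have h200 : Summit.QuantumFields.YangMills.Theses.UnitScaleTilt.MinimiserStabilityRegPr :=
    Summit.QuantumFields.YangMills.Theorems.MinimiserStabilityRegPrResidueThree.minimiserStabilityRegPr_of_exBody_three hEX3
  intro L
  exact unitTilt_shape_of_regPr L (h200 L) (h201 L)

/-- ★★★ **`UnitTilt` BY NAME ⟸ ⟨EX body at `L = 3`⟩ ∧ (L) ∧ (A) ∧ (E) ∧ (S)** — the aside 18915's registered two-stub composition with both stubs replaced by
their residues by kernel: `stub_minimiserRegPr` (= crux 19200) ↦ ✓`minimiserStabilityRegPr_of_exBody_three hEX3` (L ≥ 5 outright, p790882∕p792443), `stub_fluctuationRegPr`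
(= aside 19201) ↦ ✓`fluctuationComparisonRegPr_of_four hLane hA hE hS`; glue ✓`T3PrintedRegularMinimiser.unitTilt_shape_of_regPr` per `L` (p415317 = item 19202's
p416206).  CONDITIONAL; credits nothing.
[cite: Balaban1985Variational, Prop. 7 p.299; King1986, Thm 3.4 (3.9) p.656] -/
theorem unitTilt_of_exBodyThree_four
    (hEX3 : ∀ (B₃ : ℝ), 4 < B₃ → ∃ a₁' O₁ : ℝ, 0 < a₁' ∧ 1 ≤ O₁ ∧
      ∀ (F : T3Family), F.L = 3 → ∀ (n K : ℕ) (hnK : n < K) (ε₁ : ℝ), 0 < ε₁ →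
        ∀ V : GaugeField (F.P n) 0 (Matrix.specialUnitaryGroup (Fin 2) ℂ), PlaqSmall ε₁ V →
          ∀ U₀ : GaugeField (F.P K) 0 (Matrix.specialUnitaryGroup (Fin 2) ℂ), RegPr F n K (((3 : ℕ) : ℝ) ^ 3 * B₃ * ε₁) U₀ →
            U₀ ∈ fibre F ℰp n K hnK.le V →
            ε₁ ≤ a₁' → ∃ U ∈ regFibrePr F n K hnK.le (O₁ * ((3 : ℕ) : ℝ) ^ 3 * B₃ * ε₁) V,
              IsMinOn (fun W : GaugeField (F.P K) 0 (Matrix.specialUnitaryGroup (Fin 2) ℂ) => wilsonAction4 W)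
                (regFibrePr F n K hnK.le (O₁ * ((3 : ℕ) : ℝ) ^ 3 * B₃ * ε₁) V) U)
    (hLane : ∀ (L : ℕ), Odd L → 1 < L → Summit.QuantumFields.YangMills.Theorems.AlphaInputsT3AC L)
    (hA : ∀ (L : ℕ), Odd L → 7 ≤ L →
      ∀ 𝔠 : Summit.QuantumFields.Balaban3D.Proofs.Primitives.AlphaConsts L (Summit.QuantumFields.Balaban3D.Carriers.suGroupModel 2).N,
        ∃ ε₁ : ℝ, 0 < ε₁ ∧ ∃ a : ℝ, 0 < a ∧ ∀ (ε₀ : ℝ), 0 < ε₀ → ε₀ ≤ ε₁ → ∀ (b₀ p₀ : ℝ), 0 < b₀ → 2 < p₀ →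
          ∃ γ₁ : ℝ, 0 < γ₁ ∧ ∀ (F : T3Family) (γ : ℝ) (hF : F.L = L), 0 < γ → γ ≤ γ₁ →
            Summit.QuantumFields.YangMills.Theorems.AlphaInputsT3AC.Of F (hF ▸ 𝔠) →
              ∃ (D : AlphaDataT3 F γ) (C68 : ℝ),
                Literature.MathematicalPhysics.QuantumFieldTheory.Balaban1983to89.T3AlphaInputsACSchemas.AlphaInputsT3AC D b₀ p₀ ε₀ C68 ∧
                  TrivRegions D ∧ TwoRunLv D b₀ p₀ C68 a)
    (hE : ∀ (L : ℕ), Odd L → 1 < L → ∃ a₁ : ℝ, 0 < a₁ ∧ ∃ ε₁ : ℝ, 0 < ε₁ ∧ ∀ (ε₀ : ℝ), 0 < ε₀ → ε₀ ≤ ε₁ → ∀ (b₀ p₀ : ℝ), 0 < b₀ → 2 < p₀ →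
      ∃ γ₁ : ℝ, 0 < γ₁ ∧ ∀ (F : T3Family) (γ : ℝ), F.L = L → 0 < γ → γ ≤ γ₁ → MinimiserCauchyAt F γ ε₀ b₀ p₀ a₁)
    (hS : ∀ (L : ℕ), Odd L → 1 < L → L < 7 →
      ∃ ε₁ : ℝ, 0 < ε₁ ∧ ∀ (ε₀ : ℝ), 0 < ε₀ → ε₀ ≤ ε₁ → ∃ m₀ : ℕ, ∀ (m : ℕ), m₀ ≤ m → ∀ (b₀ p₀ : ℝ), 0 < b₀ → 2 < p₀ →
        ∃ γ₁ : ℝ, 0 < γ₁ ∧ ∀ (F : T3Family) (γ : ℝ), F.L = L → 0 < γ → γ ≤ γ₁ →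
          ∃ (r κ : ℕ → ℝ), Summable r ∧ (∀ K, 0 ≤ r K) ∧
            ∀ K, ∀ᵐ V ∂fieldMeasure (F.P (K / m)) 0 (Matrix.specialUnitaryGroup (Fin 2) ℂ),
              PlaqSmall (θBal F.L γ b₀ p₀ (K / m)) V →
                0 < heightDensity F γ (Nat.div_le_self K m) (histGood F ℰp (θBal F.L γ b₀ p₀) K (K / m)) V →
                0 < heightDensity F γ ((Nat.div_le_self K m).trans (Nat.le_succ K))
                      (histGood F ℰp (θBal F.L γ b₀ p₀) (K + 1) (K / m)) V →
                  |(Real.log (heightDensity F γ ((Nat.div_le_self K m).trans (Nat.le_succ K))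
                        (histGood F ℰp (θBal F.L γ b₀ p₀) (K + 1) (K / m)) V) + bgRegPr' F γ m ε₀ K V) -
                    (Real.log (heightDensity F γ (Nat.div_le_self K m) (histGood F ℰp (θBal F.L γ b₀ p₀) K (K / m)) V) + bgRegPr F γ m ε₀ K V) -
                      κ K| ≤ r K) :
    Summit.QuantumFields.YangMills.Theses.UnitScaleTilt.UnitTilt :=
  unitTilt_of_exBodyThree_fluctuationComparisonRegPr hEX3
    (Summit.QuantumFields.YangMills.Theorems.FluctuationComparisonRegPrOfFourV5e.fluctuationComparisonRegPr_of_four hLane hA hE hS)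

/-- ★★ **`UnitTilt` BY NAME ⟸ the NAMED fact `B8Thm2AtT3Members` ∧ `FluctuationComparisonRegPr` BY NAME** — §1 with the anonymous ⟨EX@3⟩ text replaced by
[Balaban1985RegularSpaces] Thm 2 at the T³ members (✓`minimiserStabilityRegPr_of_b8Thm2AtT3Members`, p793522).  CONDITIONAL on a named Literature fact (open at
`L = 3`); credits nothing. [cite: Balaban1985RegularSpaces, Thm 2 p.83; King1986, Thm 3.4 (3.9) p.656] -/
theorem unitTilt_of_b8Thm2AtT3Members_fluctuationComparisonRegPr (hX : B8Thm2AtT3Members)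
    (h201 : Summit.QuantumFields.YangMills.Theses.UnitScaleTilt.FluctuationComparisonRegPr) :
    Summit.QuantumFields.YangMills.Theses.UnitScaleTilt.UnitTilt := by
  have h200 : Summit.QuantumFields.YangMills.Theses.UnitScaleTilt.MinimiserStabilityRegPr :=
    Summit.QuantumFields.YangMills.Theorems.MinimiserStabilityRegPrOfB8Thm2AtT3Members.minimiserStabilityRegPr_of_b8Thm2AtT3Members hX
  intro L
  exact unitTilt_shape_of_regPr L (h200 L) (h201 L)

/-- ★★★ **`UnitTilt` BY NAME ⟸ `B8Thm2AtT3Members` ∧ (L) ∧ (A) ∧ (E) ∧ (S)** — §2 with the named fact in place of ⟨EX@3⟩: the aside 18915's residue by kernel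
= {ONE named Literature fact, the four analytic binders of aside 19201's v5e composition ✓`fluctuationComparisonRegPr_of_four`}.  CONDITIONAL; credits nothing.
[cite: Balaban1985RegularSpaces, Thm 2 p.83; Balaban1985UV3, Thm 2 p.272; King1986, Thm 3.4 (3.9) p.656] -/
theorem unitTilt_of_b8Thm2AtT3Members_four (hX : B8Thm2AtT3Members)
    (hLane : ∀ (L : ℕ), Odd L → 1 < L → Summit.QuantumFields.YangMills.Theorems.AlphaInputsT3AC L)
    (hA : ∀ (L : ℕ), Odd L → 7 ≤ L →
      ∀ 𝔠 : Summit.QuantumFields.Balaban3D.Proofs.Primitives.AlphaConsts L (Summit.QuantumFields.Balaban3D.Carriers.suGroupModel 2).N,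
        ∃ ε₁ : ℝ, 0 < ε₁ ∧ ∃ a : ℝ, 0 < a ∧ ∀ (ε₀ : ℝ), 0 < ε₀ → ε₀ ≤ ε₁ → ∀ (b₀ p₀ : ℝ), 0 < b₀ → 2 < p₀ →
          ∃ γ₁ : ℝ, 0 < γ₁ ∧ ∀ (F : T3Family) (γ : ℝ) (hF : F.L = L), 0 < γ → γ ≤ γ₁ →
            Summit.QuantumFields.YangMills.Theorems.AlphaInputsT3AC.Of F (hF ▸ 𝔠) →
              ∃ (D : AlphaDataT3 F γ) (C68 : ℝ),
                Literature.MathematicalPhysics.QuantumFieldTheory.Balaban1983to89.T3AlphaInputsACSchemas.AlphaInputsT3AC D b₀ p₀ ε₀ C68 ∧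
                  TrivRegions D ∧ TwoRunLv D b₀ p₀ C68 a)
    (hE : ∀ (L : ℕ), Odd L → 1 < L → ∃ a₁ : ℝ, 0 < a₁ ∧ ∃ ε₁ : ℝ, 0 < ε₁ ∧ ∀ (ε₀ : ℝ), 0 < ε₀ → ε₀ ≤ ε₁ → ∀ (b₀ p₀ : ℝ), 0 < b₀ → 2 < p₀ →
      ∃ γ₁ : ℝ, 0 < γ₁ ∧ ∀ (F : T3Family) (γ : ℝ), F.L = L → 0 < γ → γ ≤ γ₁ → MinimiserCauchyAt F γ ε₀ b₀ p₀ a₁)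
    (hS : ∀ (L : ℕ), Odd L → 1 < L → L < 7 →
      ∃ ε₁ : ℝ, 0 < ε₁ ∧ ∀ (ε₀ : ℝ), 0 < ε₀ → ε₀ ≤ ε₁ → ∃ m₀ : ℕ, ∀ (m : ℕ), m₀ ≤ m → ∀ (b₀ p₀ : ℝ), 0 < b₀ → 2 < p₀ →
        ∃ γ₁ : ℝ, 0 < γ₁ ∧ ∀ (F : T3Family) (γ : ℝ), F.L = L → 0 < γ → γ ≤ γ₁ →
          ∃ (r κ : ℕ → ℝ), Summable r ∧ (∀ K, 0 ≤ r K) ∧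
            ∀ K, ∀ᵐ V ∂fieldMeasure (F.P (K / m)) 0 (Matrix.specialUnitaryGroup (Fin 2) ℂ),
              PlaqSmall (θBal F.L γ b₀ p₀ (K / m)) V →
                0 < heightDensity F γ (Nat.div_le_self K m) (histGood F ℰp (θBal F.L γ b₀ p₀) K (K / m)) V →
                0 < heightDensity F γ ((Nat.div_le_self K m).trans (Nat.le_succ K))
                      (histGood F ℰp (θBal F.L γ b₀ p₀) (K + 1) (K / m)) V →
                  |(Real.log (heightDensity F γ ((Nat.div_le_self K m).trans (Nat.le_succ K))
                        (histGood F ℰp (θBal F.L γ b₀ p₀) (K + 1) (K / m)) V) + bgRegPr' F γ m ε₀ K V) -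
                    (Real.log (heightDensity F γ (Nat.div_le_self K m) (histGood F ℰp (θBal F.L γ b₀ p₀) K (K / m)) V) + bgRegPr F γ m ε₀ K V) -
                      κ K| ≤ r K) :
    Summit.QuantumFields.YangMills.Theses.UnitScaleTilt.UnitTilt :=
  unitTilt_of_b8Thm2AtT3Members_fluctuationComparisonRegPr hX
    (Summit.QuantumFields.YangMills.Theorems.FluctuationComparisonRegPrOfFourV5e.fluctuationComparisonRegPr_of_four hLane hA hE hS)

end Summit.QuantumFields.YangMills.Theorems.UnitTiltOfResidue

end
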